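import Mathlib
import Literature.AlgebraicGeometry.HodgeTheory.FermatHodgeCharacters
import HarnessLib

/-!
# The octic sparse Fermat datum `𝔇₁ = (3, 8, B₁)` is pure (crux `TropicalCycleDeficiency`,
# stmt-HodgeConjecture-18618, lines `birth` / `spread`: stubs `stub_instancePure` / `stub_pureGate`)

The character lattice `Λ ⊂ (ℤ/8)⁸` of the route `SparseFermatTropicalDeficiency` is generated by the
residues of the four seed monomials `x₁x₂x₄x₅⁴x₇, x₁x₂x₃⁴x₄x₇, x₁²x₂²x₄²x₆², x₀²x₁²x₂⁴`:
`Λ = ⟨(0,1,1,0,1,4,0,1), (0,1,1,4,1,0,0,1), (0,2,2,0,2,0,2,0), (2,2,4,0,0,0,0,0)⟩`, `|Λ| = 256`.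
We prove that every ADMISSIBLE character of `μ₈⁸` in `Λ` (all components non-zero, sum zero) is a
HODGE character (`2 |tα| = 8` for every unit `t`), i.e. Shioda's purity of the datum: the
`A_B`-invariant primitive middle cohomology of the octic sixfolds of the family is of type `(3,3)`.

Proof: `Λ` lies in (in fact equals) the solution set of the eight linear conditions
`4α₀ = 0, 4α₆ = 0, 2α₃ = 0, 2α₅ = 0, 4α₇ = α₃ + α₅, α₄ = α₇ + α₆, α₁ = α₄ + α₀, α₂ = α₄ + 2α₀`
(closure induction); admissibility then forces `α₃ = α₅ = 4` and `α₀, α₆, α₇ ∈ {2, 4, 6}`, leaving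
`27` candidates `(α₀, α₆, α₇)`, on which the four norm sums `|tα|`, `t ∈ (ℤ/8)ˣ = {1,3,5,7}`, are
evaluated (`decide` on `3³ · 4` instances of an eight-term sum of residues). Exactly `8` of the `27`
are admissible, and all `8` are Hodge (indeed paired).

The skeletons' stubs `stub_instancePure : inst.IsPure` (`Cruxes/TropicalCycleDeficiency/Lines/birth.lean`)
and `stub_pureGate : inst.IsPure` (`Lines/spread.lean`, `Spread.inst = Birth.inst`) follow in four
lines: `inst.charLattice ≤ Λ` because `B₁ = octicMonomials` is FILTERED by `residue ∈ Λ`, then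
`isHodge_of_mem_closure_seed`.
-/

-- `Summit.HodgeConjecture.HodgeConjecture.…` is the mandated namespace (single-conjunct summit).
set_option linter.dupNamespace false

namespace Summit.HodgeConjecture.HodgeConjecture.Theorems.TropicalCycleDeficiency

open Literature.AlgebraicGeometry.HodgeTheory
open Literature.AlgebraicGeometry.HodgeTheory.FermatCharacter

/-- The eight linear conditions cutting out the seed lattice `Λ ⊂ (ℤ/8)⁸` are preserved by the
closure: every element of `Λ = ⟨seed residues⟩` satisfies them. [folklore] -/
theorem seed_relations {α : Fin 8 → ZMod 8}
    (hα : α ∈ AddSubgroup.closure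
      ({![0, 1, 1, 0, 1, 4, 0, 1], ![0, 1, 1, 4, 1, 0, 0, 1], ![0, 2, 2, 0, 2, 0, 2, 0],
        ![2, 2, 4, 0, 0, 0, 0, 0]} : Set (Fin 8 → ZMod 8))) :
    4 * α 0 = 0 ∧ 4 * α 6 = 0 ∧ 2 * α 3 = 0 ∧ 2 * α 5 = 0 ∧ 4 * α 7 = α 3 + α 5 ∧
      α 4 = α 7 + α 6 ∧ α 1 = α 4 + α 0 ∧ α 2 = α 4 + 2 * α 0 := by
  induction hα using AddSubgroup.closure_induction with
  | mem x hx =>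
    simp only [Set.mem_insert_iff, Set.mem_singleton_iff] at hx
    rcases hx with rfl | rfl | rfl | rfl <;> decide
  | zero => simp
  | add x y _ _ hx hy =>
    obtain ⟨a0, a6, a3, a5, a7, a4, a1, a2⟩ := hx
    obtain ⟨b0, b6, b3, b5, b7, b4, b1, b2⟩ := hy
    simp only [Pi.add_apply]
    refine ⟨?_, ?_, ?_, ?_, ?_, ?_, ?_, ?_⟩
    · linear_combination a0 + b0
    · linear_combination a6 + b6
    · linear_combination a3 + b3
    · linear_combination a5 + b5
    · linear_combination a7 + b7
    · linear_combination a4 + b4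
    · linear_combination a1 + b1
    · linear_combination a2 + b2
  | neg x _ hx =>
    obtain ⟨a0, a6, a3, a5, a7, a4, a1, a2⟩ := hx
    simp only [Pi.neg_apply]
    refine ⟨?_, ?_, ?_, ?_, ?_, ?_, ?_, ?_⟩
    · linear_combination -a0
    · linear_combination -a6
    · linear_combination -a3
    · linear_combination -a5
    · linear_combination -a7
    · linear_combination -a4
    · linear_combination -a1
    · linear_combination -a2

/-- In `ℤ/8`: `4x = 0`, `x ≠ 0` forces `x ∈ {2, 4, 6}`. [folklore] -/
theorem eq_two_or_four_or_six_of_four_mul {x : ZMod 8} (h : 4 * x = 0) (hx : x ≠ 0) :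
    x = 2 ∨ x = 4 ∨ x = 6 := by
  revert x; decide

/-- In `ℤ/8`: `2x = 0`, `x ≠ 0` forces `x = 4`. [folklore] -/
theorem eq_four_of_two_mul {x : ZMod 8} (h : 2 * x = 0) (hx : x ≠ 0) : x = 4 := by
  revert x; decide

/-- The units of `ℤ/8` are `1, 3, 5, 7`. [folklore] -/
theorem units_zmod_eight (t : (ZMod 8)ˣ) :
    (t : ZMod 8) = 1 ∨ (t : ZMod 8) = 3 ∨ (t : ZMod 8) = 5 ∨ (t : ZMod 8) = 7 := by
  have key : ∀ a b : ZMod 8, a * b = 1 → a = 1 ∨ a = 3 ∨ a = 5 ∨ a = 7 := by decide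
  exact key _ _ t.mul_inv

/-- The finite heart: for `x, y, s ∈ {2,4,6}` and `t ∈ {1,3,5,7}`, if the character
`(x, s+y+x, s+y+2x, 4, s+y, 4, y, s)` has no zero component then each of its four unit multiples has
norm sum `32 = 8·8/2` (`27 · 4` evaluations of an eight-term sum of residues). [folklore] -/
theorem two_mul_normSum_candidates :
    ∀ x y s t : ZMod 8, (x = 2 ∨ x = 4 ∨ x = 6) → (y = 2 ∨ y = 4 ∨ y = 6) →
      (s = 2 ∨ s = 4 ∨ s = 6) → (t = 1 ∨ t = 3 ∨ t = 5 ∨ t = 7) →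
      s + y ≠ 0 → s + y + x ≠ 0 → s + y + 2 * x ≠ 0 →
      2 * ((t * x).val + (t * (s + y + x)).val + (t * (s + y + 2 * x)).val + (t * 4).val +
        (t * (s + y)).val + (t * 4).val + (t * y).val + (t * s).val) = 64 := by
  set_option synthInstance.maxSize 1024 in
  decide

/-- **Purity of the octic datum `𝔇₁`**: every admissible character of `μ₈⁸` in the seed lattice
`Λ = ⟨(0,1,1,0,1,4,0,1), (0,1,1,4,1,0,0,1), (0,2,2,0,2,0,2,0), (2,2,4,0,0,0,0,0)⟩ ⊂ (ℤ/8)⁸` is a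
Hodge character (`2|tα| = 64` for all units `t`). This is the content of the registered stubs
`stub_instancePure` / `stub_pureGate` (`inst.IsPure`) of the crux `TropicalCycleDeficiency`, whose
character lattice `inst.charLattice` is contained in `Λ` by construction of `B₁`.
[cite: Shioda1979PJA, §1 eq. (2) and §4] -/
theorem isHodge_of_mem_closure_seed {α : Fin 8 → ZMod 8}
    (hα : α ∈ AddSubgroup.closure
      ({![0, 1, 1, 0, 1, 4, 0, 1], ![0, 1, 1, 4, 1, 0, 0, 1], ![0, 2, 2, 0, 2, 0, 2, 0],
        ![2, 2, 4, 0, 0, 0, 0, 0]} : Set (Fin 8 → ZMod 8)))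
    (hadm : IsAdmissible α) : IsHodge α := by
  obtain ⟨h0, h6, h3, h5, h7, h4, h1, h2⟩ := seed_relations hα
  have hne := hadm.1
  have e3 : α 3 = 4 := eq_four_of_two_mul h3 (hne 3)
  have e5 : α 5 = 4 := eq_four_of_two_mul h5 (hne 5)
  have h7' : 4 * α 7 = 0 := by
    rw [h7, e3, e5]; decide
  have hx := eq_two_or_four_or_six_of_four_mul h0 (hne 0)
  have hy := eq_two_or_four_or_six_of_four_mul h6 (hne 6)
  have hs := eq_two_or_four_or_six_of_four_mul h7' (hne 7)
  refine ⟨hadm, fun t ↦ ?_⟩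
  have ht := units_zmod_eight t
  have n4 : α 7 + α 6 ≠ 0 := h4 ▸ hne 4
  have n1 : α 7 + α 6 + α 0 ≠ 0 := by rw [← h4, ← h1]; exact hne 1
  have n2 : α 7 + α 6 + 2 * α 0 ≠ 0 := by rw [← h4, ← h2]; exact hne 2
  have key := two_mul_normSum_candidates (α 0) (α 6) (α 7) (t : ZMod 8) hx hy hs ht n4 n1 n2
  simp only [normSum, Fin.sum_univ_eight]
  rw [h1, h2, h4, e3, e5]
  convert key using 2

end Summit.HodgeConjecture.HodgeConjecture.Theorems.TropicalCycleDeficiency
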